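import Mathlib
import HarnessLib
import Summits.ValiantsHypothesis.ValiantsHypothesis.Theorems.KPlusLogSqLawWeakLiftingTowerGraftTwoSidedLoewner

/-!
# Route «KPlusLogSqLaw», `WeakLifting` (stmt-ValiantsHypothesis-19561) — mixed-gauge series: the Loewner form of `y ↦ yᵖ` is
# STRICTLY positive definite at distinct positive nodes for EVERY real `0 < p < 1`, and the DOWNWARD LAW holds at every ratio

HONEST FRAMING.  Helper file (hand leafhand-val-kpluslogsqlaw-1 g14, cell `pub-symmetroid` / `decomp-valiant`, 2026-08-31;
`--supports stmt-ValiantsHypothesis-19561 --as helper`, zero crux / stub credit), continuing val-sym-lift-p4 g26's MIXED-GAUGE series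
(`…MixedGaugeTwoClassRatioThree`, `…MixedGaugeCubeLoewnerKernel`, `…MixedGaugeTwoThirdsLoewnerKernel`): there the two-class law
`ζ ≤ n + 2m` for `[[A + X^a·1, B], [Bᵀ, C − X^b·1]]` was proved at the two ratios `b/a = 3` and `3/2`, each time from ONE classical
positivity — the Loewner kernel of `t ↦ t^{1/3}`, resp. `t^{2/3}`, typed ad hoc by explicit cube integrals.  THIS FILE supplies the
kernel fact ONCE FOR EVERY REAL EXPONENT `0 < p < 1`, in the currency of val-sym-lift-p3 g21's `…TowerGraftTwoSidedLoewner`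
(Mathlib's `Real.rpow_eq_const_mul_integral`): the Loewner matrix `K_{ik} = ∫₀^∞ tᵖ dt/((t + yᵢ)(t + yₖ))`
(`K_{ik}·(yᵢ − yₖ) = c·(yᵢᵖ − yₖᵖ)`, `K_{ii} = c·p·yᵢᵖ⁻¹`, `c = ∫₀^∞ rpowIntegrand₀₁ p t 1 > 0`; g21 proved it positive SEMIdefinite)
is STRICTLY positive definite at pairwise distinct positive nodes (`loewnerForm_pos`: the Gram integral `∫ tᵖ (Σ xᵢ/(t+yᵢ))²` of a
rational function that cannot vanish on `(0,∞)` unless `x = 0` — `exists_sum_div_add_ne_zero`, Lagrange evaluation at `−yⱼ`), and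
the ABSTRACT DOWNWARD LAW of the series for every exponent (`down_card_le_blocks_rpow`): `m + 1` distinct positive nodes `Yⱼ`
carrying non-zero data `(wⱼ, qⱼ) ∈ ℝⁿ × ℝᵐ` with the two-point identities `(Yₖᵖ − Yⱼᵖ)⟪wⱼ,wₖ⟫ = (Yₖ − Yⱼ)⟪qⱼ,qₖ⟫` and all
DOWNWARD (`p·Yⱼᵖ⁻¹‖wⱼ‖² ≤ ‖qⱼ‖²`) cannot exist.  For the block pencil `[[A + X^a·1, B], [Bᵀ, C − X^b·1]]` (`1 ≤ a < b`) this is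
«at most `m` downward positive zeros» at EVERY exponent pair (nodes `Y = x^b`, `p = a/b`; sequel file); the cases `p = 1/3`, `2/3`
are the tree's.  Nothing here is about `WeakLifting` / `TropicalB` in their windows, the registered stubs of `tower_graft.lean`, the
doors, `MatrixDescartes` (18050) or VP ≠ VNP.  No `def`; axioms standard.  [Löwner 1934 / Heinz 1951: `yᵖ` is operator monotone for
`0 ≤ p ≤ 1`, its Loewner matrices are positive definite at distinct nodes; folklore linear algebra for the downward law]
-/

set_option linter.dupNamespace false
set_option autoImplicit false

namespace Summit.ValiantsHypothesis.ValiantsHypothesis.Theorems.KPlusLogSqLaw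

namespace MixedGauge

open MeasureTheory Set Filter Real Matrix Finset
open scoped Topology BigOperators
open Summit.ValiantsHypothesis.ValiantsHypothesis.Theorems.KPlusLogSqLaw.TowerGraft.TwoSidedThree.Loewner

/-! ## 1. The rational function `t ↦ Σ xᵢ/(t + yᵢ)` does not vanish identically on `(0, ∞)` -/

/-- For pairwise distinct positive poles `−yᵢ` and a non-zero coefficient vector `x` there is `t > 0` with `Σᵢ xᵢ/(t + yᵢ) ≠ 0`
(otherwise the polynomial `Σⱼ xⱼ ∏_{l ≠ j} (X + yₗ)` has infinitely many roots, hence vanishes, and its value at `−yⱼ` gives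
`xⱼ = 0`). [folklore] -/
theorem exists_sum_div_add_ne_zero {k : ℕ} (y x : Fin k → ℝ) (hy : ∀ i, 0 < y i) (hinj : Function.Injective y)
    (hx : x ≠ 0) : ∃ t : ℝ, 0 < t ∧ ∑ i, x i / (t + y i) ≠ 0 := by
  classical
  by_contra hall
  push Not at hall
  let P : Polynomial ℝ := ∑ j, Polynomial.C (x j) * ∏ l ∈ Finset.univ.erase j, (Polynomial.X + Polynomial.C (y l))
  have hevalP : ∀ t : ℝ, P.eval t = ∑ j, x j * ∏ l ∈ Finset.univ.erase j, (t + y l) := by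
    intro t
    simp only [P, Polynomial.eval_finsetSum, Polynomial.eval_mul, Polynomial.eval_C, Polynomial.eval_prod,
      Polynomial.eval_add, Polynomial.eval_X]
  have hroot : ∀ t : ℝ, 0 < t → P.eval t = 0 := by
    intro t ht
    have hsum := hall t ht
    rw [hevalP]
    have hprod : ∀ j, x j * ∏ l ∈ Finset.univ.erase j, (t + y l) =
        (∏ l, (t + y l)) * (x j / (t + y j)) := by
      intro j
      have hj : t + y j ≠ 0 := by have := hy j; positivity
      rw [← Finset.prod_erase_mul (Finset.univ) (fun l => t + y l) (Finset.mem_univ j)]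
      field_simp
    simp_rw [hprod, ← Finset.mul_sum, hsum, mul_zero]
  have hP0 : P = 0 := by
    apply Polynomial.eq_zero_of_infinite_isRoot
    exact (Set.Ioi_infinite (0:ℝ)).mono fun t ht => hroot t ht
  have hxj : ∀ j, x j = 0 := by
    intro j
    have h := hevalP (-(y j))
    rw [hP0, Polynomial.eval_zero] at h
    have hsplit := (Finset.sum_erase_add (Finset.univ)
      (fun j' => x j' * ∏ l ∈ Finset.univ.erase j', (-(y j) + y l)) (Finset.mem_univ j)).symm
    rw [hsplit] at h
    have hothers : ∑ j' ∈ Finset.univ.erase j, x j' * ∏ l ∈ Finset.univ.erase j', (-(y j) + y l) = 0 := by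
      refine Finset.sum_eq_zero fun j' hj' => ?_
      have hne : j' ≠ j := (Finset.mem_erase.mp hj').1
      rw [Finset.prod_eq_zero (Finset.mem_erase.mpr ⟨hne.symm, Finset.mem_univ j⟩) (by ring), mul_zero]
    rw [hothers, zero_add] at h
    have hprod : ∏ l ∈ Finset.univ.erase j, (-(y j) + y l) ≠ 0 := by
      rw [Finset.prod_ne_zero_iff]
      intro l hl
      have hne : l ≠ j := (Finset.mem_erase.mp hl).1
      intro h0
      have : y l = y j := by linarith
      exact hne (hinj this)
    exact (mul_eq_zero.mp h.symm).resolve_right hprod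
  exact hx (funext hxj)

/-! ## 2. The Loewner form of `y ↦ yᵖ` as a Gram integral; strict positivity at distinct nodes -/

/-- **Gram integral of the Loewner form.**  `Σᵢₗ xᵢ K_{iₗ} xₗ = ∫₀^∞ tᵖ (Σᵢ xᵢ/(t + yᵢ))² dt` with
`K_{iₗ} = ∫₀^∞ tᵖ/((t + yᵢ)(t + yₗ)) dt` (positive nodes, `0 < p < 1`). [folklore] -/
theorem loewnerForm_eq_integral {k : ℕ} (p : ℝ) (hp : p ∈ Set.Ioo (0:ℝ) 1) (y x : Fin k → ℝ) (hy : ∀ i, 0 < y i) :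
    (∑ i, ∑ l, x i * (∫ t in Ioi 0, t ^ p / ((t + y i) * (t + y l))) * x l)
      = ∫ t in Ioi 0, t ^ p * (∑ i, x i / (t + y i)) ^ 2 := by
  have hint : ∀ i l, IntegrableOn (fun t : ℝ => t ^ p / ((t + y i) * (t + y l))) (Ioi 0) :=
    fun i l => integrableOn_kernel p (y i) (y l) hp (hy i) (hy l)
  have hswap : (∑ i, ∑ l, x i * (∫ t in Ioi 0, t ^ p / ((t + y i) * (t + y l))) * x l)
      = ∫ t in Ioi 0, ∑ i, ∑ l, x i * (t ^ p / ((t + y i) * (t + y l))) * x l := by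
    rw [integral_finsetSum _ fun i _ => ?_]
    · refine Finset.sum_congr rfl fun i _ => ?_
      rw [integral_finsetSum _ fun l _ => ?_]
      · refine Finset.sum_congr rfl fun l _ => ?_
        rw [integral_mul_const, integral_const_mul]
      · exact ((hint i l).const_mul (x i)).mul_const (x l)
    · exact integrable_finsetSum _ fun l _ => ((hint i l).const_mul (x i)).mul_const (x l)
  rw [hswap]
  exact setIntegral_congr_fun measurableSet_Ioi fun t ht => sum_sum_kernel_eq_sq p y x ht hy

/-- **The Loewner form is non-negative** (positive nodes, `0 < p < 1`). [folklore] -/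
theorem loewnerForm_nonneg {k : ℕ} (p : ℝ) (hp : p ∈ Set.Ioo (0:ℝ) 1) (y x : Fin k → ℝ) (hy : ∀ i, 0 < y i) :
    0 ≤ ∑ i, ∑ l, x i * (∫ t in Ioi 0, t ^ p / ((t + y i) * (t + y l))) * x l := by
  rw [loewnerForm_eq_integral p hp y x hy]
  exact setIntegral_nonneg measurableSet_Ioi fun t ht =>
    mul_nonneg (Real.rpow_nonneg (le_of_lt ht) _) (sq_nonneg _)

/-- **STRICT positive definiteness of the Loewner matrix of `y ↦ yᵖ` (`0 < p < 1`) at pairwise distinct positive nodes**: for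
`x ≠ 0`, `0 < Σᵢₗ xᵢ K_{iₗ} xₗ`.  (The integrand `tᵖ (Σ xᵢ/(t+yᵢ))²` is continuous, non-negative and positive near a point where the
rational function does not vanish.) [Löwner 1934 / Heinz 1951; folklore calculus] -/
theorem loewnerForm_pos {k : ℕ} (p : ℝ) (hp : p ∈ Set.Ioo (0:ℝ) 1) (y x : Fin k → ℝ) (hy : ∀ i, 0 < y i)
    (hinj : Function.Injective y) (hx : x ≠ 0) :
    0 < ∑ i, ∑ l, x i * (∫ t in Ioi 0, t ^ p / ((t + y i) * (t + y l))) * x l := by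
  rw [loewnerForm_eq_integral p hp y x hy]
  obtain ⟨t₀, ht₀, hR⟩ := exists_sum_div_add_ne_zero y x hy hinj hx
  let g : ℝ → ℝ := fun t => t ^ p * (∑ i, x i / (t + y i)) ^ 2
  have hint : ∀ i l, IntegrableOn (fun t : ℝ => t ^ p / ((t + y i) * (t + y l))) (Ioi 0) :=
    fun i l => integrableOn_kernel p (y i) (y l) hp (hy i) (hy l)
  have hgint : IntegrableOn g (Ioi 0) := by
    refine IntegrableOn.congr_fun ?_ (fun t ht => sum_sum_kernel_eq_sq p y x ht hy) measurableSet_Ioi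
    exact integrable_finsetSum _ fun i _ => integrable_finsetSum _ fun l _ =>
      ((hint i l).const_mul (x i)).mul_const (x l)
  show 0 < ∫ t in Ioi 0, g t
  rw [setIntegral_pos_iff_support_of_nonneg_ae ?_ hgint]
  · have hg0 : 0 < g t₀ := by
      have h1 : 0 < (∑ i, x i / (t₀ + y i)) ^ 2 := by positivity
      exact mul_pos (Real.rpow_pos_of_pos ht₀ p) h1
    have hcontOn : ContinuousOn g (Ioi 0) := by
      refine ContinuousOn.mul ?_ (ContinuousOn.pow ?_ 2)
      · exact ContinuousOn.rpow_const continuousOn_id fun t ht => Or.inl (ne_of_gt ht)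
      · refine continuousOn_finsetSum _ fun i _ => ?_
        refine ContinuousOn.div continuousOn_const (by fun_prop) ?_
        intro t ht
        have : (0:ℝ) < t := ht
        have := hy i
        positivity
    have hcont : ContinuousAt g t₀ := hcontOn.continuousAt (Ioi_mem_nhds ht₀)
    have hev : ∀ᶠ t in 𝓝 t₀, 0 < g t := hcont.eventually (lt_mem_nhds hg0)
    obtain ⟨ε, hε, hball⟩ := Metric.eventually_nhds_iff.mp hev
    let δ : ℝ := min ε t₀ / 2
    have hδ : 0 < δ := by positivity
    have hsub : Ioo (t₀ - δ) (t₀ + δ) ⊆ Function.support g ∩ Ioi 0 := by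
      intro t ht
      rw [Set.mem_Ioo] at ht
      have hδε : δ < ε := by
        have : min ε t₀ ≤ ε := min_le_left _ _
        simp only [δ]; linarith
      have hδt : δ < t₀ := by
        have : min ε t₀ ≤ t₀ := min_le_right _ _
        simp only [δ]; linarith
      refine ⟨?_, ?_⟩
      · have : 0 < g t := hball (by rw [Real.dist_eq, abs_lt]; constructor <;> linarith)
        exact ne_of_gt this
      · show 0 < t
        linarith
    calc (0 : ENNReal) < volume (Ioo (t₀ - δ) (t₀ + δ)) := by
          rw [Real.volume_Ioo]; exact ENNReal.ofReal_pos.mpr (by linarith)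
      _ ≤ volume (Function.support g ∩ Ioi 0) := measure_mono hsub
  · rw [EventuallyLE, ae_restrict_iff' measurableSet_Ioi]
    exact Filter.Eventually.of_forall fun t ht => by
      have ht' : (0:ℝ) < t := ht
      simp only [Pi.zero_apply, g]
      exact mul_nonneg (Real.rpow_nonneg ht'.le _) (sq_nonneg _)

/-! ## 3. The abstract DOWNWARD LAW at every exponent `0 < p < 1` -/

/-- **Downward law, every exponent.**  For `0 < p < 1`: `m + 1` pairwise distinct positive nodes `Yⱼ` with NON-ZERO data
`(wⱼ, qⱼ) ∈ ℝⁿ × ℝᵐ`, the two-point identities `(Yₖᵖ − Yⱼᵖ)·⟪wⱼ,wₖ⟫ = (Yₖ − Yⱼ)·⟪qⱼ,qₖ⟫` (`j ≠ k`) and all DOWNWARD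
(`p·Yⱼᵖ⁻¹·‖wⱼ‖² ≤ ‖qⱼ‖²`) cannot exist: a dependency `Σ cⱼqⱼ = 0` among the `m + 1` fast components expands, through the identities,
into the Loewner form of `y ↦ yᵖ` at the nodes applied coordinatewise to `(cⱼwⱼ(i))ⱼ` plus non-negative diagonal excesses; strict
positive definiteness forces `cⱼwⱼ = 0`, then `qⱼ = 0` at some `cⱼ ≠ 0`.  The cases `p = 1/3` (`…TwoClassRatioThree`) and `p = 2/3`
(`…RatioThreeHalves`) are the tree's. [folklore] -/
theorem down_card_le_blocks_rpow {n m : ℕ} (p : ℝ) (hp : p ∈ Set.Ioo (0:ℝ) 1)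
    (Y : Fin (m + 1) → ℝ) (hY : ∀ j, 0 < Y j) (hinj : Function.Injective Y)
    (w : Fin (m + 1) → (Fin n → ℝ)) (q : Fin (m + 1) → (Fin m → ℝ)) (hnz : ∀ j, w j ≠ 0 ∨ q j ≠ 0)
    (hid : ∀ j k, j ≠ k → (Y k ^ p - Y j ^ p) * (w j ⬝ᵥ w k) = (Y k - Y j) * (q j ⬝ᵥ q k))
    (hdown : ∀ j, p * Y j ^ (p - 1) * (w j ⬝ᵥ w j) ≤ q j ⬝ᵥ q j) : False := by
  classical
  -- a relation among the m + 1 fast components in ℝᵐ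
  let f : (Fin (m + 1) → ℝ) →ₗ[ℝ] (Fin m → ℝ) :=
    { toFun := fun d => ∑ j, d j • q j
      map_add' := by
        intro d d'
        simp only [Pi.add_apply, add_smul, Finset.sum_add_distrib]
      map_smul' := by
        intro r d
        simp only [Pi.smul_apply, smul_eq_mul, mul_smul, ← Finset.smul_sum, RingHom.id_apply] }
  have hker : LinearMap.ker f ≠ ⊥ := by
    apply LinearMap.ker_ne_bot_of_finrank_lt
    rw [Module.finrank_fin_fun, Module.finrank_fin_fun]
    omega
  obtain ⟨c, hcker, hc0⟩ := (Submodule.ne_bot_iff _).mp hker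
  have hsumq : ∑ j, c j • q j = 0 := LinearMap.mem_ker.mp hcker
  -- the normalised Loewner kernel `L j k = c₀⁻¹ ∫ tᵖ/((t + Yⱼ)(t + Yₖ))`
  set c₀ : ℝ := ∫ t in Ioi 0, rpowIntegrand₀₁ p t 1 with hc₀def
  have hc₀ : 0 < c₀ := integral_rpowIntegrand₀₁_one_pos hp
  set L : Fin (m + 1) → Fin (m + 1) → ℝ :=
    fun j k => c₀⁻¹ * ∫ t in Ioi 0, t ^ p / ((t + Y j) * (t + Y k)) with hLdef
  have hLdiag : ∀ j, L j j = p * Y j ^ (p - 1) := by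
    intro j
    simp only [hLdef]
    rw [integral_kernel_diag p (Y j) hp (hY j), ← hc₀def, ← mul_assoc, inv_mul_cancel₀ (ne_of_gt hc₀), one_mul]
  have hLoff : ∀ j k, j ≠ k → q j ⬝ᵥ q k = L j k * (w j ⬝ᵥ w k) := by
    intro j k hjk
    have hne : Y j - Y k ≠ 0 := sub_ne_zero.mpr (fun h => hjk (hinj h))
    have hK := integral_kernel_mul_sub p (Y j) (Y k) hp (hY j) (hY k)
    rw [← hc₀def] at hK
    -- from hid: (Y k ^ p - Y j ^ p) * ww = (Y k - Y j) * qq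
    have h := hid j k hjk
    have hL : L j k * (Y j - Y k) = Y j ^ p - Y k ^ p := by
      simp only [hLdef]
      rw [mul_assoc, hK, ← mul_assoc, inv_mul_cancel₀ (ne_of_gt hc₀), one_mul]
    -- qq * (Y j - Y k) = ww * (Y j ^ p - Y k ^ p) = ww * L j k * (Y j - Y k)
    have h2 : (Y j - Y k) * (q j ⬝ᵥ q k) = (Y j - Y k) * (L j k * (w j ⬝ᵥ w k)) := by
      have : (Y j - Y k) * (q j ⬝ᵥ q k) = (Y j ^ p - Y k ^ p) * (w j ⬝ᵥ w k) := by linear_combination h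
      rw [this, ← hL]; ring
    exact mul_left_cancel₀ hne h2
  have hLpos : ∀ x : Fin (m + 1) → ℝ, x ≠ 0 → 0 < ∑ j, ∑ k, x j * L j k * x k := by
    intro x hx
    have h := loewnerForm_pos p hp Y x hY hinj hx
    have heq : ∑ j, ∑ k, x j * L j k * x k
        = c₀⁻¹ * ∑ j, ∑ k, x j * (∫ t in Ioi 0, t ^ p / ((t + Y j) * (t + Y k))) * x k := by
      rw [Finset.mul_sum]
      refine Finset.sum_congr rfl fun j _ => ?_
      rw [Finset.mul_sum]
      refine Finset.sum_congr rfl fun k _ => ?_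
      simp only [hLdef]; ring
    rw [heq]
    exact mul_pos (inv_pos.mpr hc₀) h
  have hLnn : ∀ x : Fin (m + 1) → ℝ, 0 ≤ ∑ j, ∑ k, x j * L j k * x k := by
    intro x
    by_cases hx : x = 0
    · subst hx; simp
    · exact le_of_lt (hLpos x hx)
  -- expand 0 = ‖Σ cⱼ qⱼ‖²
  have hzero : (∑ j, c j • q j) ⬝ᵥ (∑ k, c k • q k) = 0 := by rw [hsumq, dotProduct_zero]
  have hexp : (∑ j, c j • q j) ⬝ᵥ (∑ k, c k • q k) = ∑ j, ∑ k, c j * c k * (q j ⬝ᵥ q k) := by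
    rw [sum_dotProduct]
    refine Finset.sum_congr rfl fun j _ => ?_
    rw [dotProduct_sum]
    refine Finset.sum_congr rfl fun k _ => ?_
    rw [smul_dotProduct, dotProduct_smul, smul_eq_mul, smul_eq_mul]
    ring
  have hterm : ∀ j k, c j * c k * (q j ⬝ᵥ q k) =
      (∑ i, (c j * w j i) * L j k * (c k * w k i))
        + (if j = k then c j ^ 2 * (q j ⬝ᵥ q j - p * Y j ^ (p - 1) * (w j ⬝ᵥ w j)) else 0) := by
    intro j k
    have hsum : ∑ i, (c j * w j i) * L j k * (c k * w k i) = c j * c k * (L j k * (w j ⬝ᵥ w k)) := by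
      rw [dotProduct, Finset.mul_sum, Finset.mul_sum]
      refine Finset.sum_congr rfl fun i _ => ?_
      ring
    rw [hsum]
    by_cases hjk : j = k
    · subst hjk
      rw [if_pos rfl, hLdiag j]
      ring
    · rw [if_neg hjk, add_zero, hLoff j k hjk]
  have hdouble : ∑ j, ∑ k, c j * c k * (q j ⬝ᵥ q k) =
      (∑ j, ∑ k, ∑ i, (c j * w j i) * L j k * (c k * w k i))
        + ∑ j, c j ^ 2 * (q j ⬝ᵥ q j - p * Y j ^ (p - 1) * (w j ⬝ᵥ w j)) := by
    simp_rw [hterm, Finset.sum_add_distrib, Finset.sum_ite_eq, Finset.mem_univ, if_true]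
  have hcomm : ∑ j, ∑ k, ∑ i, (c j * w j i) * L j k * (c k * w k i) =
      ∑ i, ∑ j, ∑ k, (c j * w j i) * L j k * (c k * w k i) := by
    calc (∑ j, ∑ k, ∑ i, (c j * w j i) * L j k * (c k * w k i))
        = ∑ j, ∑ i, ∑ k, (c j * w j i) * L j k * (c k * w k i) :=
          Finset.sum_congr rfl fun j _ => Finset.sum_comm
      _ = ∑ i, ∑ j, ∑ k, (c j * w j i) * L j k * (c k * w k i) := Finset.sum_comm
  have hKi : ∀ i, 0 ≤ ∑ j, ∑ k, (c j * w j i) * L j k * (c k * w k i) := fun i => hLnn (fun j => c j * w j i)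
  have hA : 0 ≤ ∑ j, ∑ k, ∑ i, (c j * w j i) * L j k * (c k * w k i) := by
    rw [hcomm]; exact Finset.sum_nonneg fun i _ => hKi i
  have hexcess : ∀ j, 0 ≤ q j ⬝ᵥ q j - p * Y j ^ (p - 1) * (w j ⬝ᵥ w j) := fun j => by linarith [hdown j]
  have hB : 0 ≤ ∑ j, c j ^ 2 * (q j ⬝ᵥ q j - p * Y j ^ (p - 1) * (w j ⬝ᵥ w j)) :=
    Finset.sum_nonneg fun j _ => mul_nonneg (sq_nonneg _) (hexcess j)
  rw [hexp, hdouble] at hzero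
  have hA0 : ∑ j, ∑ k, ∑ i, (c j * w j i) * L j k * (c k * w k i) = 0 := by linarith
  have hB0 : ∑ j, c j ^ 2 * (q j ⬝ᵥ q j - p * Y j ^ (p - 1) * (w j ⬝ᵥ w j)) = 0 := by linarith
  -- every coordinate vector (cⱼ wⱼ(i))ⱼ vanishes
  have hcw : ∀ j i, c j * w j i = 0 := by
    intro j i
    rw [hcomm] at hA0
    have hi0 := (Finset.sum_eq_zero_iff_of_nonneg fun i _ => hKi i).mp hA0 i (Finset.mem_univ _)
    by_contra hne
    have hci : (fun j => c j * w j i) ≠ 0 := fun h => hne (congrFun h j)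
    have := hLpos (fun j => c j * w j i) hci
    linarith
  obtain ⟨j0, hj0⟩ : ∃ j, c j ≠ 0 := by
    by_contra h
    push Not at h
    exact hc0 (funext h)
  have hw0 : w j0 = 0 := by
    funext i
    rcases mul_eq_zero.mp (hcw j0 i) with h | h
    · exact absurd h hj0
    · exact h
  have hB0' := (Finset.sum_eq_zero_iff_of_nonneg fun j _ => mul_nonneg (sq_nonneg _) (hexcess j)).mp hB0 j0
    (Finset.mem_univ _)
  have hq0 : q j0 ⬝ᵥ q j0 = 0 := by
    have hc2 : c j0 ^ 2 ≠ 0 := pow_ne_zero 2 hj0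
    have := (mul_eq_zero.mp hB0').resolve_left hc2
    rw [hw0, dotProduct_zero, mul_zero, sub_zero] at this
    exact this
  have hq0' : q j0 = 0 := dotProduct_self_eq_zero.mp hq0
  rcases hnz j0 with h | h
  · exact h hw0
  · exact h hq0'

end MixedGauge

end Summit.ValiantsHypothesis.ValiantsHypothesis.Theorems.KPlusLogSqLaw
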